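import Summits.BirchSwinnertonDyer.BirchSwinnertonDyer.Theorems.ByReductionTypeAtTwoUniformKatoHalfSharp
import Summits.BirchSwinnertonDyer.BirchSwinnertonDyer.Theorems.ByReductionTypeAtTwoAdditiveKatoPlusTwoDefs
import HarnessLib

/-!
# Route `ByReductionTypeAtTwo` (rung K4), the four rank-`0` cruxes at once: the Kato half at `2` UP TO TWO BITS on
# the WHOLE irreducible-`E[2]` locus — `ord₂ #Ш ≤ ord₂ #Ш_an + 2` for EVERY non-CM analytic-rank-`0` curve with
# irreducible `E[2]`, whatever its reduction at `2`, from Coates–Sujatha's statement (A) at `(E,2)` alone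
# (seat `bsd-2adic-addL2x` GEN 14; `--supports`; sequel of `…UniformKatoHalfSharp.lean`)

HONEST FRAMING (cell `bsd-2adic`, HUMAN RULING D-0036/D-0054): types-the-object-of; closes none at the ∀-level; nothing
booked; BSD is not proved by any of this. Conditional helpers; no item is closed by this file.

WHAT THIS FILE DOES. `…UniformKatoHalfSharp.lean` (p659664) gives the SHARP Kato half `MissingUpperBoundAt W 2` on
{irreducible `E[2]`} ∖ {additive with a split multiplicative twist by `−1` or `−2`} from the three sharp readings. On
the two excluded twist classes the lane's reading loses `+ 1` (twist by `−2`, Literature fact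
`…_le_add_one_at_two_of_noSplitTwistNegOne_…`, GEN 13) resp. `+ 2` (twist by `−1`; step T18, filed — after the review
verdict on p659491 — as the Summits-side typed target `AddKatoTwo.KatoPlusTwoAtTwoAdditive`, p659890, which carries
`+ 2` for EVERY additive curve). Hence, with NO exception left:

* §1 `padicValNat_shaOrder_le_add_two_of_katoPlusTwo_rankZero` — the `+ 2` target in Miller's currency on the additive
  block: `#Ш_an = q`, `ord₂ #Ш ≤ ord₂ q + 2 − 2·ord₂ #E(ℚ)_tors`.
* §2 `shaOrder_le_shaAn_add_two_at_two_uniform` — for EVERY non-CM globally minimal `W` of analytic rank `0` with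
  irreducible `E[2]`, (A) at `(W,2)` gives `∃ q, #Ш_an(W) = q ∧ ord₂ #Ш(W) ≤ ord₂ q + 2`, by cases on the reduction at
  `2` (good / multiplicative: the sharp doors, a fortiori; additive: §1).
* §3 `rankZeroAtTwo_shaBoundUpToTwo_onIrreducible_of_conjA` — BLOCK form: the same on the whole irreducible locus of
  rung K4's rank-`0` part from the two sharp readings + the `+ 2` target + PRINT {GZK, modularity, Lim@2, FW} + ONE
  research `∀`-object `hAnaIrr` ((A) on the `S₃`-image curves). I.e. modulo (A) (= Iwasawa's `μ₂ = 0` for the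
  `S₃`-sextics `ℚ(W[2])`) the Euler-system half of BSD₂ at `2` holds UP TO A FACTOR `4` for EVERY non-CM rank-`0`
  curve without rational `2`-torsion; sharp off the 208 (−1)/(−2)-split additive census classes.

Binders (BY NAME): `hKG`, `hKM` (p658927), `hP2 : AddKatoTwo.KatoPlusTwoAtTwoAdditive` (p659890, MEMO-tier target);
`hGZK`; `hmod`; `hLim2`, `hFW`. Memo: `run/shared/lean/pub/bsd-2adic/addL2x/VERDICT-19098-addL2x-GEN14.md`.

References: [Kato2004Asterisque] Thm. 12.5 (1)(3), (12.5.1) (pp. 221–222), 13.13 (pp. 233–234), 14.14–14.16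
(pp. 243–245); [Tate1975] §1; [CoatesSujatha2005] statement (A); [Lim2017FineSelmer] §3 Thm. 3.5;
[FerreroWashington1979]; [Miller2011LMS] Def. 1.1.
-/

set_option autoImplicit false
-- sibling precedent (`ByReductionTypeAtTwoUniformKatoHalfSharp.lean`): the directory name repeats the summit name
set_option linter.dupNamespace false

noncomputable section

open scoped Classical

namespace Summit.BirchSwinnertonDyer.BirchSwinnertonDyer.Theorems.SemistableKatoTwo

open WeierstrassCurve Literature.NumberTheory.EllipticCurves
  Literature.NumberTheory.EllipticCurves.Rank1Residual
  Literature.NumberTheory.EllipticCurves.Rank1Residual.Typed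
  Literature.NumberTheory.IwasawaTheory
  Summit.BirchSwinnertonDyer.BirchSwinnertonDyer.Theorems.AddKatoTwo

/-! ## §1 The `+ 2` target in Miller's currency (additive block) -/

/-- **Rank-`0` upper bound `+ 2` on the additive block**: for a non-CM globally minimal `W`, additive at `2`, with
`E[2]` irreducible, `r_an = 0` and statement (A) at `(E,2)`, granted the target `hP2`: `#Ш_an = q` and
`ord₂ #Ш ≤ ord₂ q + 2 − 2·ord₂ #E(ℚ)_tors`. Proof as the sharp doors with `+ 2` carried along.
[cite: Kato2004Asterisque, Thm. 12.5 (3) and (12.5.1) (p. 222), 13.13 (pp. 233–234), 14.14 and Lemma 14.15 (pp. 243–244)]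
[cite: CoatesSujatha2005, statement (A)] [cite: Miller2011LMS, Def. 1.1] -/
theorem padicValNat_shaOrder_le_add_two_of_katoPlusTwo_rankZero
    (hP2 : KatoPlusTwoAtTwoAdditive)
    (hGZK : rank_eq_analyticRank_of_analyticRank_le_one) (hmod : hasEntireLFunction_rat)
    (W : WeierstrassCurve ℚ) [W.IsElliptic] [W.IsGloballyMinimal] (hcm : ¬ W.HasCM)
    (hgood : ¬ W.HasGoodReductionAtPrime 2) (hmult : ¬ W.HasMultiplicativeReductionAtPrime 2)
    (hirr : W.HasIrreducibleModPGaloisRep 2)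
    (hA : ∀ (κ : ZpExtension ℚ 2), κ.IsCyclotomic →
      ∃ (γ : Field.absoluteGaloisGroup ℚ) (D : W.FineSelmerDualData κ γ),
        Module.Finite ℤ_[2] (RestrictScalars ℤ_[2] (IwasawaAlgebra 2) D.X))
    (hr : W.analyticRank = 0) :
    ∃ q : ℚ, shaAn W = (q : ℂ) ∧
      (padicValNat 2 W.shaOrder : ℤ) ≤ padicValRat 2 q + 2 - 2 * padicValNat 2 W.torsionOrder := by
  have hL : W.entireLFunction 1 ≠ 0 := (W.analyticRank_eq_zero_iff_holds (hmod W)).mp hr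
  obtain ⟨hmw, hfin⟩ := hGZK W (by rw [hr]; exact zero_le_one)
  haveI : Finite W.sha := hfin
  have hmw0 : W.mordellWeilRank = 0 := by rw [hmw, hr]
  obtain ⟨q₀, hq₀, hle⟩ := hP2 W hcm hgood hmult hirr hA hL hfin
  have hΩpos : 0 < W.realPeriodRat := W.realPeriodRat_pos_holds
  have hΩ : (W.realPeriodRat : ℂ) ≠ 0 := by exact_mod_cast hΩpos.ne'
  have hc0 : 0 < W.tamagawaProduct := W.tamagawaProduct_pos_holds
  have ht0 : 0 < W.torsionOrder := W.torsionOrder_pos_holds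
  have hq₀0 : q₀ ≠ 0 := by
    rintro rfl
    rw [Rat.cast_zero, div_eq_zero_iff] at hq₀
    exact hq₀.elim hL hΩ
  refine ⟨q₀ * (W.torsionOrder : ℚ) ^ 2 / (W.tamagawaProduct : ℚ), ?_, ?_⟩
  · have hLq : W.entireLFunction 1 = (q₀ : ℂ) * (W.realPeriodRat : ℂ) := by
      rw [← hq₀, div_mul_cancel₀ _ hΩ]
    rw [shaAn_def, leadingLCoeff_eq_of_analyticRank_eq_zero W hr,
      W.regulator_eq_one_of_rank_zero hmw0, hLq]
    push_cast
    field_simp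
  · have ht : (W.torsionOrder : ℚ) ≠ 0 := by exact_mod_cast ht0.ne'
    have hcq : (W.tamagawaProduct : ℚ) ≠ 0 := by exact_mod_cast hc0.ne'
    have hsha : padicValNat 2 (Nat.card (AddCommGroup.primaryComponent W.sha 2)) =
        padicValNat 2 W.shaOrder := by
      unfold WeierstrassCurve.shaOrder
      exact padicValNat_card_addPrimaryComponent 2
    have hv : padicValRat 2 (q₀ * (W.torsionOrder : ℚ) ^ 2 / (W.tamagawaProduct : ℚ)) =
        padicValRat 2 q₀ + 2 * (padicValNat 2 W.torsionOrder : ℤ) -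
          (padicValNat 2 W.tamagawaProduct : ℤ) := by
      rw [padicValRat.div (mul_ne_zero hq₀0 (pow_ne_zero 2 ht)) hcq,
        padicValRat.mul hq₀0 (pow_ne_zero 2 ht), pow_two, padicValRat.mul ht ht,
        padicValRat.of_nat, padicValRat.of_nat]
      ring
    rw [hv, ← hsha]
    linarith

/-! ## §2 The Kato half UP TO TWO BITS, uniformly -/

/-- **THE KATO HALF AT `2` UP TO TWO BITS, FOR EVERY CURVE OF THE IRREDUCIBLE LOCUS.** For every non-CM globally minimal
`W` of analytic rank `0` with irreducible `E[2]`, statement (A) at `(W,2)` gives `#Ш_an(W) = q ∈ ℚ` with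
`ord₂ #Ш(W) ≤ ord₂ q + 2` — WHATEVER the reduction of `W` at `2`, with NO twist hypothesis. Granted the two sharp
semistable readings `hKG`, `hKM` (there the bound is sharp, a fortiori `+ 2`), the additive `+ 2` target `hP2`, GZK
and modularity; by cases on the reduction at `2`; torsion term `0` by irreducibility. [cite: Kato2004Asterisque, Thm. 12.5 (1)(3) and (12.5.1) (pp. 221–222), 13.13 (pp. 233–234), 14.14 (p. 243)]
[cite: Tate1975, §1] [cite: CoatesSujatha2005, statement (A)] [cite: Miller2011LMS, Def. 1.1] -/
theorem shaOrder_le_shaAn_add_two_at_two_uniform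
    (hKG : Kato2004.rankZero_padicValNat_sha_add_padicValNat_tamagawa_le_at_two_of_good_of_irreducible_of_fineSelmerDual_fg)
    (hKM : Kato2004.rankZero_padicValNat_sha_add_padicValNat_tamagawa_le_at_two_of_multiplicative_of_irreducible_of_fineSelmerDual_fg)
    (hP2 : KatoPlusTwoAtTwoAdditive)
    (hGZK : rank_eq_analyticRank_of_analyticRank_le_one) (hmod : hasEntireLFunction_rat)
    (W : WeierstrassCurve ℚ) [W.IsElliptic] [W.IsGloballyMinimal] (hcm : ¬ W.HasCM) (hr : W.analyticRank = 0)
    (hirr : W.HasIrreducibleModPGaloisRep 2)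
    (hA : ∀ (κ : ZpExtension ℚ 2), κ.IsCyclotomic →
      ∃ (γ : Field.absoluteGaloisGroup ℚ) (D : W.FineSelmerDualData κ γ),
        Module.Finite ℤ_[2] (RestrictScalars ℤ_[2] (IwasawaAlgebra 2) D.X)) :
    ∃ q : ℚ, shaAn W = (q : ℂ) ∧ (padicValNat 2 W.shaOrder : ℤ) ≤ padicValRat 2 q + 2 := by
  haveI : Fact (Nat.Prime 2) := ⟨Nat.prime_two⟩
  by_cases hgood : W.HasGoodReductionAtPrime 2
  · obtain ⟨q, hq, hle⟩ := missingUpperBoundAt_two_of_katoAtTwoGood hKG hGZK hmod W hcm hr hgood hirr hA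
    exact ⟨q, hq, by linarith⟩
  · by_cases hmult : W.HasMultiplicativeReductionAtPrime 2
    · obtain ⟨q, hq, hle⟩ := missingUpperBoundAt_two_of_katoAtTwoMult hKM hGZK hmod W hcm hr hmult hirr hA
      exact ⟨q, hq, by linarith⟩
    · obtain ⟨q, hq, hle⟩ :=
        padicValNat_shaOrder_le_add_two_of_katoPlusTwo_rankZero hP2 hGZK hmod W hcm hgood hmult hirr hA hr
      rw [padicValNat_torsionOrder_eq_zero_of_irreducible W 2 hirr] at hle
      simp only [Nat.cast_zero, mul_zero, sub_zero] at hle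
      exact ⟨q, hq, hle⟩

/-! ## §3 BLOCK form for the route -/

/-- **The Euler-system half of BSD₂ at `2` UP TO A FACTOR `4` for EVERY non-CM rank-`0` curve WITHOUT rational
`2`-torsion** (the whole irreducible locus of rung K4's rank-`0` part, all four reduction types, no twist hypothesis),
from the two sharp semistable readings + the additive `+ 2` target + PRINT {GZK, modularity, Lim@2, FW} + ONE research
`∀`-object `hAnaIrr` = statement (A) at `(W,2)` on those curves whose `2`-division field is NOT abelian (Iwasawa's
`μ₂ = 0` for the `S₃`-sextics `ℚ(W[2])`). On the curves off the 208 (−1)/(−2)-split additive census classes the sharp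
form is `rankZeroAtTwo_upper_onIrreducible_of_conjA` (sibling file). Conditional; closes nothing.
[cite: Kato2004Asterisque, Thm. 12.5 (3) and (12.5.1) (p. 222), 13.13 (pp. 233–234), 14.14 (p. 243)]
[cite: CoatesSujatha2005, statement (A)] [cite: Lim2017FineSelmer, §3 Thm. 3.5] [cite: FerreroWashington1979, Theorem]
[cite: Miller2011LMS, Def. 1.1] -/
theorem rankZeroAtTwo_shaBoundUpToTwo_onIrreducible_of_conjA
    (hKG : Kato2004.rankZero_padicValNat_sha_add_padicValNat_tamagawa_le_at_two_of_good_of_irreducible_of_fineSelmerDual_fg)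
    (hKM : Kato2004.rankZero_padicValNat_sha_add_padicValNat_tamagawa_le_at_two_of_multiplicative_of_irreducible_of_fineSelmerDual_fg)
    (hP2 : KatoPlusTwoAtTwoAdditive)
    (hGZK : rank_eq_analyticRank_of_analyticRank_le_one) (hmod : hasEntireLFunction_rat)
    (hLim2 : Lim2017.thm35_at_two_fineSelmerDual_moduleFinite_of_classicalMuVanishes_of_le_divisionField_four)
    (hFW : ferreroWashington1979_classicalMuVanishes)
    (hAnaIrr : ∀ (W : WeierstrassCurve ℚ) [W.IsElliptic] [W.IsGloballyMinimal], ¬ W.HasCM → W.analyticRank = 0 →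
      W.HasIrreducibleModPGaloisRep 2 → ¬ IsAbelianGalois ℚ (W.divisionField 2) →
      ∀ (κ : ZpExtension ℚ 2), κ.IsCyclotomic →
        ∃ (γ : Field.absoluteGaloisGroup ℚ) (D : W.FineSelmerDualData κ γ),
          Module.Finite ℤ_[2] (RestrictScalars ℤ_[2] (IwasawaAlgebra 2) D.X)) :
    ∀ (W : WeierstrassCurve ℚ) [W.IsElliptic] [W.IsGloballyMinimal], ¬ W.HasCM → W.analyticRank = 0 →
      W.HasIrreducibleModPGaloisRep 2 →
      ∃ q : ℚ, shaAn W = (q : ℂ) ∧ (padicValNat 2 W.shaOrder : ℤ) ≤ padicValRat 2 q + 2 := by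
  intro W _ _ hcm hr hirr
  by_cases hab : IsAbelianGalois ℚ (W.divisionField 2)
  · haveI := hab
    exact shaOrder_le_shaAn_add_two_at_two_uniform hKG hKM hP2 hGZK hmod W hcm hr hirr
      (conjA_two_of_isAbelianGalois_divisionField_two hLim2 hFW W)
  · exact shaOrder_le_shaAn_add_two_at_two_uniform hKG hKM hP2 hGZK hmod W hcm hr hirr
      (hAnaIrr W hcm hr hirr hab)

end Summit.BirchSwinnertonDyer.BirchSwinnertonDyer.Theorems.SemistableKatoTwo

end
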